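import Literature.Computability.Complexity.IrreducibilityLLLDecide
import Literature.Computability.Complexity.IrreducibilityLLLBerlekampFP
import Literature.Computability.Complexity.IrreducibilityLLLPrimeSearchFP
import Literature.Algebra.EuclideanLattices.LatticeTableCodeFP
import HarnessLib

/-!
# The LLL irreducibility test runs in polynomial time (`CodeFP`)

Support file for the discharge of the named fact
`Literature.Computability.Complexity.lll_monicIrreducible_mem_P` (irreducibility of monic integer
polynomials is decidable in `P`; Lenstra–Lenstra–Lovász 1982, §3). Machine side of
`IrreducibilityLLLDecide.lean`: the test `irredTest` of that file is the value of a polynomial-time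
string function on the codes of coefficient lists (`CodeFP (listE smE) bitE irredTest`), by
composition (Arora–Barak 2009, §1.3) of

* the bricks of the sibling `…FP` files (`trimC`, `goodPrimeC`, `berlekampFactorC`, `henselLiftC`,
  arithmetic);
* **the lattice step** (LLL82 (3.3)–(3.4)): the rows of the basis (2.3) as lists (`factorRows`,
  `toMat_factorRows`), the code of the instance (`latticeTableFP` of the lattice topic), the tree's
  LLL MACHINE `LLLMachine.lllMachineF ∈ FP` (LLL82 Prop. 1.26, `lllMachineF_encode`), and the sum of
  squares of the first `n` entries of its output (`firstRowSqNormC`);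
* `irredTestCoreC`, `irredTestMonicC`, **`irredTestC`**.

## References

* A. K. Lenstra, H. W. Lenstra Jr., L. Lovász, *Factoring polynomials with rational coefficients*,
  Math. Ann. 261 (1982) 515–534, §3 (3.1)–(3.6), Prop. 1.26. [LenstraLenstraLovasz1982]
* S. Arora, B. Barak, *Computational Complexity: A Modern Approach*, CUP 2009, §1.3. [AroraBarak2009]
-/

noncomputable section

namespace Literature.Computability.Complexity

open Polynomial SumcheckMA CodeFP Brick _root_.Computability Literature.Algebra.EuclideanLattices

namespace LLLFactoring

/-- The encoder of coefficient lists. -/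
local notation "L" => rawE intE

/-- The encoder of the lattice data `(n, d, U, m)` (`n`, `d` unary, `m` binary). -/
local notation "LD" => pairE unE (pairE unE (pairE (rawE intE) natE))

/-! ### The lattice of LLL82 (2.3) as a list matrix -/

/-- The rows of the basis matrix `factorMatrix n d u m` as lists: `m Xⁱ` for `i < d`, `u X^{i-d}`
for `d ≤ i < n`. [cite: LenstraLenstraLovasz1982, (2.3)] -/
def factorRows (n d : ℕ) (U : List ℤ) (m : ℕ) : List (List ℤ) :=
  (List.range n).map fun i => if i < d then List.replicate i 0 ++ [(m : ℤ)] else List.replicate (i - d) 0 ++ U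

/-- Entries of a shifted list. [folklore] -/
theorem getD_replicate_append (k : ℕ) (l : List ℤ) (j : ℕ) :
    (List.replicate k 0 ++ l).getD j 0 = if j < k then 0 else l.getD (j - k) 0 := by
  rw [List.getD_eq_getElem?_getD, List.getD_eq_getElem?_getD]
  split_ifs with h
  · rw [List.getElem?_append_left (by simpa using h), List.getElem?_replicate, if_pos h]; rfl
  · rw [List.getElem?_append_right (by simpa using Nat.le_of_not_lt h), List.length_replicate]

/-- **The list rows are the basis matrix** (as read by `toMat`). [cite: LenstraLenstraLovasz1982, (2.3)] -/
theorem toMat_factorRows (n d : ℕ) (U : List ℤ) (m : ℕ) :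
    LMat.toMat n n (factorRows n d U m) = factorMatrix n d (ofCoeffs U) m := by
  ext i j
  rw [factorMatrix_apply, LMat.toMat, LMat.ent, factorRows, List.getD_eq_getElem?_getD (l := List.map _ _), List.getElem?_map,
    List.getElem?_range i.isLt, Option.map_some, Option.getD_some, rowPoly]
  split_ifs with h
  · rw [getD_replicate_append, coeff_C_mul, coeff_X_pow]
    rcases Nat.lt_trichotomy (j : ℕ) i with hji | hji | hij
    · rw [if_pos hji, if_neg hji.ne, mul_zero]
    · rw [if_neg hji.not_lt, if_pos hji, hji, Nat.sub_self, mul_one]; rfl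
    · rw [if_neg (not_lt.2 hij.le), if_neg hij.ne', mul_zero]
      obtain ⟨k, hk⟩ : ∃ k, (j : ℕ) - i = k + 1 := ⟨j - i - 1, by omega⟩
      rw [hk]; rfl
  · rw [getD_replicate_append, coeff_mul_X_pow']
    by_cases hj : (j : ℕ) < i - d
    · rw [if_pos hj, if_neg (not_le.2 hj)]
    · rw [if_neg hj, if_pos (not_lt.1 hj), coeff_ofCoeffs]

/-- **The rows on codes**: a `map` over the unary range `[0, n)` with context `(d, U, m)`.
[cite: AroraBarak2009, §1.3] -/
theorem factorRowsC : CodeFP LD LMat.matE (fun t => factorRows t.1 t.2.1 t.2.2.1 t.2.2.2) := by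
  -- context `c = (d, U, m)`, item `i` (unary)
  have hi : CodeFP (pairE (pairE unE (pairE L natE)) unE) unE (fun q => q.2) := snd _ _
  have hd : CodeFP (pairE (pairE unE (pairE L natE)) unE) unE (fun q => q.1.1) := (fst _ _).fst'
  have hU : CodeFP (pairE (pairE unE (pairE L natE)) unE) L (fun q => q.1.2.1) := (fst _ _).snd'.fst'
  have hm : CodeFP (pairE (pairE unE (pairE L natE)) unE) natE (fun q => q.1.2.2) := (fst _ _).snd'.snd'
  have hlt : CodeFP (pairE (pairE unE (pairE L natE)) unE) bitE (fun q => decide (q.2 < q.1.1)) :=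
    (natLt.comp ((natOfUn.comp hi).pair (natOfUn.comp hd)) :)
  have hrow₁ : CodeFP (pairE (pairE unE (pairE L natE)) unE) L (fun q => List.replicate q.2 0 ++ [(q.1.2.2 : ℤ)]) :=
    ((rawAppend intE).comp (((replicateOf intE).comp ((const _ (0 : ℤ)).pair hi)).pair
      ((rawSingleton intE).comp (intOfNat.comp hm))) :)
  have hsub : CodeFP (pairE (pairE unE (pairE L natE)) unE) unE (fun q => q.2 - q.1.1) := by
    have h : CodeFP (pairE (pairE unE (pairE L natE)) unE) unE (fun q => min (q.2 - q.1.1) q.2) :=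
      (unOfNatMin.comp (hi.pair (natSub.comp ((natOfUn.comp hi).pair (natOfUn.comp hd)))) :)
    exact h.congr fun q => min_eq_left (Nat.sub_le _ _)
  have hrow₂ : CodeFP (pairE (pairE unE (pairE L natE)) unE) L (fun q => List.replicate (q.2 - q.1.1) 0 ++ q.1.2.1) :=
    ((rawAppend intE).comp (((replicateOf intE).comp ((const _ (0 : ℤ)).pair hsub)).pair hU) :)
  have hrows : CodeFP LD LMat.matE (fun t => (List.range t.1).map fun i =>
      if decide (i < t.2.1) then List.replicate i 0 ++ [(t.2.2.2 : ℤ)] else List.replicate (i - t.2.1) 0 ++ t.2.2.1) :=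
    ((map (hlt.ite hrow₁ hrow₂)).comp ((snd _ _).pair (urangeUn.comp (fst _ _))) :)
  refine hrows.congr fun t => List.map_congr_left fun i _ => ?_
  by_cases h : i < t.2.1
  · rw [if_pos h, if_pos (decide_eq_true h)]
  · rw [if_neg h, if_neg (by rw [decide_eq_true_eq]; exact h)]

/-! ### The LLL machine and the first reduced vector -/

/-- The tree's LLL machine as a `CodeFP` brick on strings. [cite: LenstraLenstraLovasz1982, Prop. (1.26)] -/
theorem lllMachineC : CodeFP strE strE LLLMachine.lllMachineF := of_fn _ LLLMachine.lllMachineF_mem_FP fun _ => rfl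

/-- **The machine output on the lattice of (2.3)**: `(n, d, U, m) ↦ (n, machineEntries (factorInstance n d U m))`
(the instance code is built from the list rows, the machine is run, and its output code is READ as
the dimension header and the row-major entry list). [cite: LenstraLenstraLovasz1982, (3.3), Prop. (1.26)] [cite: AroraBarak2009, §1.3] -/
theorem machineEntriesC : CodeFP LD (pairE natE (listE smE))
    (fun t => (t.1, machineEntries (factorInstance t.1 t.2.1 (ofCoeffs t.2.2.1) t.2.2.2))) := by
  have h1 : CodeFP LD strE (fun t => LatticeInstance.encode ⟨t.1, LMat.toMat t.1 t.1 (factorRows t.1 t.2.1 t.2.2.1 t.2.2.2)⟩) :=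
    (latticeTableFP.comp ((fst _ _).pair factorRowsC) :)
  have h2 : CodeFP LD strE
      (fun t => LLLMachine.lllMachineF (LatticeInstance.encode ⟨t.1, LMat.toMat t.1 t.1 (factorRows t.1 t.2.1 t.2.2.1 t.2.2.2)⟩)) :=
    (lllMachineC.comp h1 :)
  refine h2.recodeOut fun t => ?_
  rw [toMat_factorRows,
    show (⟨t.1, factorMatrix t.1 t.2.1 (ofCoeffs t.2.2.1) t.2.2.2⟩ : LatticeInstance) = factorInstance t.1 t.2.1 (ofCoeffs t.2.2.1) t.2.2.2
      from rfl, LLLMachine.lllMachineF_encode, latticeInstance_encode_eq]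
  rfl

/-- **`firstRowSqNorm` on codes**: the sum of the squares of the first `n` machine entries.
[cite: LenstraLenstraLovasz1982, (3.4)–(3.5)] [cite: AroraBarak2009, §1.3] -/
theorem firstRowSqNormC : CodeFP LD intE (fun t => firstRowSqNorm t.1 t.2.1 t.2.2.1 t.2.2.2) := by
  have hE' : CodeFP LD L (fun t => (id (machineEntries (factorInstance t.1 t.2.1 (ofCoeffs t.2.2.1) t.2.2.2))).map id) :=
    ((map₀ intOfSM).comp ((rawOfList smE).comp machineEntriesC.snd') :)
  have hE : CodeFP LD L (fun t => machineEntries (factorInstance t.1 t.2.1 (ofCoeffs t.2.2.1) t.2.2.2)) :=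
    hE'.congr fun t => List.map_id _
  have htake : CodeFP LD L (fun t => (machineEntries (factorInstance t.1 t.2.1 (ofCoeffs t.2.2.1) t.2.2.2)).take t.1) :=
    ((rawTakeUn intE).comp ((fst _ _).pair hE) :)
  have hsq : CodeFP LD L (fun t => ((machineEntries (factorInstance t.1 t.2.1 (ofCoeffs t.2.2.1) t.2.2.2)).take t.1).map fun x => x * x) :=
    ((map₀ (intMul.comp ((CodeFP.id _).pair (CodeFP.id _)))).comp htake :)
  exact (intSum.comp hsq).congr fun t => by unfold firstRowSqNorm; rfl

/-! ### The test -/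

/-- The encoder of `(f, n, p)` (`n`, `p` unary). -/
local notation "CI" => pairE (rawE intE) (pairE unE unE)

/-- The realised form of `irredTestCore` (decided condition). [folklore] -/
theorem irredTestCore_eq' (f : List ℤ) (n p : ℕ) :
    (if decide ((berlekampFactor p (pnorm p f)).length - 1 = n) then true else
      decide (testBound n (sqNormList f) <
        firstRowSqNorm n ((berlekampFactor p (pnorm p f)).length - 1)
          (henselLift p (precisionExp n (sqNormList f)) f (berlekampFactor p (pnorm p f)))
          (p ^ precisionExp n (sqNormList f)))) = irredTestCore f n p := by
  unfold irredTestCore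
  by_cases h : (berlekampFactor p (pnorm p f)).length - 1 = n
  · rw [decide_eq_true h, if_pos rfl, if_pos h]
  · rw [decide_eq_false h, if_neg Bool.false_ne_true, if_neg h]

/-- **`irredTestCore f n p⁺` on codes** (`n`, `p` unary; every step modulo `p⁺ = max p 2`, the prime
itself when `p` is prime). [cite: LenstraLenstraLovasz1982, (3.1)–(3.5)] [cite: AroraBarak2009, §1.3] -/
theorem irredTestCoreC : CodeFP CI bitE (fun t => irredTestCore t.1 t.2.1 (max t.2.2 2)) := by
  have hf : CodeFP CI L (fun t => t.1) := fst _ _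
  have hn : CodeFP CI unE (fun t => t.2.1) := (snd _ _).fst'
  have hp : CodeFP CI unE (fun t => t.2.2) := (snd _ _).snd'
  have hPn : CodeFP CI natE (fun t => max t.2.2 2) := maxTwoUnC.comp hp
  -- `W = berlekampFactor p⁺ (f mod p⁺)` and `d = |W| - 1`
  have hW : CodeFP CI L (fun t => berlekampFactor (max t.2.2 2) (pnorm (max t.2.2 2) t.1)) :=
    (berlekampFactorC.comp (hp.pair (pnormC.comp (hPn.pair hf))) :)
  have hd : CodeFP CI unE (fun t => (berlekampFactor (max t.2.2 2) (pnorm (max t.2.2 2) t.1)).length - 1) :=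
    (predLengthU.comp hW :)
  -- `S = |f|²`, the bounds and the exponent `k`
  have hS : CodeFP CI intE (fun t => (sqNormList t.1 : ℤ)) := (intOfNat.comp (sqNormListC.comp hf) :)
  have hn1 : CodeFP CI unE (fun t => t.2.1 - 1) := ((unSubLen unitE).comp (hn.pair (const _ [()])) :)
  have hT : CodeFP CI intE (fun t => testBound t.2.1 (sqNormList t.1)) := by
    have h : CodeFP CI intE (fun t => (2 : ℤ) ^ (t.2.1 - 1) * ((t.2.1 : ℤ) * 4 ^ t.2.1 * (sqNormList t.1 : ℤ))) :=
      (intMul.comp ((intPow.comp ((const _ (2 : ℤ)).pair hn1)).pair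
        (intMul.comp ((intMul.comp ((intOfNat.comp (natOfUn.comp hn)).pair (intPow.comp ((const _ (4 : ℤ)).pair hn)))).pair hS))) :)
    exact h.congr fun t => rfl
  have hB : CodeFP CI intE (fun t => precisionBound t.2.1 (sqNormList t.1)) := by
    have h : CodeFP CI intE (fun t => (sqNormList t.1 : ℤ) ^ (t.2.1 - 1) * testBound t.2.1 (sqNormList t.1) ^ t.2.1) :=
      (intMul.comp ((intPow.comp (hS.pair hn1)).pair (intPow.comp (hT.pair hn))) :)
    exact h.congr fun t => rfl
  have hk : CodeFP CI unE (fun t => precisionExp t.2.1 (sqNormList t.1)) := by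
    have h : CodeFP CI unE (fun t => Nat.size (precisionBound t.2.1 (sqNormList t.1)).toNat + 1) :=
      (unSucc.comp (Khot.unSize.comp (intToNat.comp hB)) :)
    exact h.congr fun t => rfl
  -- the modulus, the lifted factor and the first reduced vector
  have hm : CodeFP CI natE (fun t => max t.2.2 2 ^ precisionExp t.2.1 (sqNormList t.1)) := (natPow.comp (hPn.pair hk) :)
  have hU : CodeFP CI L (fun t => henselLift (max t.2.2 2) (precisionExp t.2.1 (sqNormList t.1)) t.1
      (berlekampFactor (max t.2.2 2) (pnorm (max t.2.2 2) t.1))) :=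
    (henselLiftC.comp (hp.pair (hk.pair (hf.pair hW))) :)
  have hF : CodeFP CI intE (fun t => firstRowSqNorm t.2.1 ((berlekampFactor (max t.2.2 2) (pnorm (max t.2.2 2) t.1)).length - 1)
      (henselLift (max t.2.2 2) (precisionExp t.2.1 (sqNormList t.1)) t.1 (berlekampFactor (max t.2.2 2) (pnorm (max t.2.2 2) t.1)))
      (max t.2.2 2 ^ precisionExp t.2.1 (sqNormList t.1))) :=
    (firstRowSqNormC.comp (hn.pair (hd.pair (hU.pair hm))) :)
  -- the decision
  have hdec : CodeFP CI bitE (fun t =>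
      if decide ((berlekampFactor (max t.2.2 2) (pnorm (max t.2.2 2) t.1)).length - 1 = t.2.1) then true else
        decide (testBound t.2.1 (sqNormList t.1) <
          firstRowSqNorm t.2.1 ((berlekampFactor (max t.2.2 2) (pnorm (max t.2.2 2) t.1)).length - 1)
            (henselLift (max t.2.2 2) (precisionExp t.2.1 (sqNormList t.1)) t.1 (berlekampFactor (max t.2.2 2) (pnorm (max t.2.2 2) t.1)))
            (max t.2.2 2 ^ precisionExp t.2.1 (sqNormList t.1)))) :=
    ((natEq.comp ((natOfUn.comp hd).pair (natOfUn.comp hn))).ite (const _ true) (intLt.comp (hT.pair hF)) :)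
  exact hdec.congr fun t => irredTestCore_eq' t.1 t.2.1 (max t.2.2 2)

/-- `irredTestMonic` with the `match` as `Option.elim`. [folklore] -/
theorem irredTestMonic_eq (f : List ℤ) : irredTestMonic f =
    if f.length - 1 = 0 then false else if f.length - 1 = 1 then true else
      (goodPrime f).elim false fun p => irredTestCore f (f.length - 1) p := by
  unfold irredTestMonic
  cases goodPrime f <;> rfl

/-- The realised form of `irredTestMonic` (decided conditions, `p⁺` for the prime found). [folklore] -/
theorem irredTestMonic_eq' (f : List ℤ) :
    (if decide (f.length - 1 = 0) then false else if decide (f.length - 1 = 1) then true else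
      (goodPrime f).elim false fun p => irredTestCore f (f.length - 1) (max p 2)) = irredTestMonic f := by
  rw [irredTestMonic_eq]
  by_cases h0 : f.length - 1 = 0
  · rw [decide_eq_true h0, if_pos rfl, if_pos h0]
  · rw [decide_eq_false h0, if_neg Bool.false_ne_true, if_neg h0]
    by_cases h1 : f.length - 1 = 1
    · rw [decide_eq_true h1, if_pos rfl, if_pos h1]
    · rw [decide_eq_false h1, if_neg Bool.false_ne_true, if_neg h1]
      cases hg : goodPrime f with
      | none => rw [Option.elim_none, Option.elim_none]
      | some p => rw [Option.elim_some, Option.elim_some, max_eq_left (goodPrime_some hg).1.two_le]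

/-- **`irredTestMonic` on codes.** [cite: LenstraLenstraLovasz1982, (3.6)] [cite: AroraBarak2009, §1.3] -/
theorem irredTestMonicC : CodeFP L bitE irredTestMonic := by
  have hcore : CodeFP (pairE L unE) bitE (fun q => irredTestCore q.1 (q.1.length - 1) (max q.2 2)) :=
    (irredTestCoreC.comp ((fst _ _).pair ((predLengthU.comp (fst _ _)).pair (snd _ _))) :)
  have hopt : CodeFP (pairE L (optE unE)) bitE (fun q => q.2.elim false fun p => irredTestCore q.1 (q.1.length - 1) (max p 2)) :=
    optCases (k := fun s o => o.elim false fun p => irredTestCore s (s.length - 1) (max p 2))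
      (const _ false) hcore (fun _ => rfl) (fun _ _ => rfl)
  have hlast : CodeFP L bitE (fun f => (goodPrime f).elim false fun p => irredTestCore f (f.length - 1) (max p 2)) :=
    (hopt.comp ((CodeFP.id _).pair goodPrimeC) :)
  have h0 : CodeFP L bitE (fun f => decide (f.length - 1 = 0)) := (natEq.comp ((natOfUn.comp predLengthU).pair (const _ 0)) :)
  have h1 : CodeFP L bitE (fun f => decide (f.length - 1 = 1)) := (natEq.comp ((natOfUn.comp predLengthU).pair (const _ 1)) :)
  have h : CodeFP L bitE (fun f => if decide (f.length - 1 = 0) then false else if decide (f.length - 1 = 1) then true else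
      (goodPrime f).elim false fun p => irredTestCore f (f.length - 1) (max p 2)) :=
    (h0.ite (const _ false) (h1.ite (const _ true) hlast) :)
  exact h.congr irredTestMonic_eq'

/-- The realised form of `irredTest` (the monicity test reads the last entry of the trimmed list,
`0` if empty). [folklore] -/
theorem irredTest_eq' (l : List ℤ) :
    (if decide ((trim l).getLast?.getD 0 = 1) then irredTestMonic (trim l) else false) = irredTest l := by
  rw [irredTest]
  cases h : (trim l).getLast? with
  | none => simp
  | some x => by_cases hx : x = 1 <;> simp [hx]

/-- **`irredTest` on coefficient lists, on codes.** [cite: LenstraLenstraLovasz1982, (3.1)–(3.6)] [cite: AroraBarak2009, §1.3] -/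
theorem irredTestRawC : CodeFP L bitE irredTest := by
  have hq : CodeFP L bitE (fun l => decide ((trim l).getLast?.getD 0 = 1)) :=
    (intEq.comp ((lastEntryC.comp trimC).pair (const _ (1 : ℤ))) :)
  have h : CodeFP L bitE (fun l => if decide ((trim l).getLast?.getD 0 = 1) then irredTestMonic (trim l) else false) :=
    (hq.ite (irredTestMonicC.comp trimC) (const _ false) :)
  exact h.congr irredTest_eq'

/-- **The irreducibility test on the codes of integer lists** (`encodingIntBool.listBool`, i.e.
`listE smE`). [cite: LenstraLenstraLovasz1982, (3.6)] [cite: AroraBarak2009, §1.3] -/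
theorem irredTestC : CodeFP (listE smE) bitE irredTest := by
  have h : CodeFP (listE smE) bitE (fun l => irredTest ((id l).map id)) :=
    (irredTestRawC.comp ((map₀ intOfSM).comp (rawOfList smE)) :)
  exact h.congr fun l => congrArg irredTest (List.map_id _)

end LLLFactoring

end Literature.Computability.Complexity
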